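import Summits.CriticalPhenomena.Ising3DConformalLimit.Theses.PersistenceSpeed
import Literature.Probability.LatticeModels.HighDimPointwiseTriviality
import Literature.Probability.LatticeModels.GKSInequalities
import Literature.Probability.LatticeModels.CriticalFKIsingBoxCrossingLower
import Literature.Probability.LatticeModels.CriticalEtaUpperDCPProofs
import Literature.Probability.LatticeModels.TwoPointSupNormMonotone
import Literature.Probability.LatticeModels.IsingTranslationInvariance
import HarnessLib

/-!
# `BoundedBoundarySignal` (item stmt-CriticalPhenomena-18094) — Negative/structural I: the dictionary

Structural knowledge about the crux `…Theses.PersistenceSpeed.BoundedBoundarySignal` (BBS):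
`∃ K ≥ 2, ∃ A, ∀ L ≥ 1, Σ_{x∈Λ_L} ⟨σ_x⟩⁺_{Λ_{KL};β_c(3),0} ≤ A · (Σ_{x,y∈Λ_L} ⟨σ₀σ_{x-y}⟩⁺_{β_c})^{1/2}`, from the refuter's
crux attack at birth (no kill).  Notation: `lhs K L` (the boundary signal), `bulk L` (the bulk variance sum `sd_L²`),
`boxMag R = m⁺_R = ⟨σ₀⟩⁺_{Λ_R;β_c,0}` (the one-arm quantity of crux stmt-15591).

* `bbs_iff` — the shorthands are the route decl verbatim; `one_le_bulk`, `lhs_nonneg`, `lhs_le_card` — no junk values;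
  `bulk_le_pow_five`, `sqrt_bulk_le_pow` — `bulk L ≤ C₅L⁵` (infrared bound + shell count: `sd_L ≲ L^{5/2}`);
* `swapped_trivial` — the `∀ L ∃ A` reading is empty: the quantifier order is load-bearing; `at_zero` — the excluded
  instance `L = 0` holds for all `K`, `A ≥ 1` (`1 ≤ L` is decoration); `witness_nonneg` — every witness has `A ≥ 0`;
  `isingCorr_plus_singleton_of_not_mem` — spins off the volume are frozen (for the false `K = 0` slice of part II);
* `lhs_anti`, `slice_mono`, `bbs_iff_cofinal` — GKS volume antitonicity: the `K`-slices are monotone, BBS yields every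
  larger aspect ratio with the same constant;
* `corr_le_boxMag`, `boxMag_le_corr`, `lhs_le_card_mul_boxMag`, `card_mul_boxMag_le_lhs` — TRANSLATION SANDWICH
  `|Λ_L|·m⁺_{KL+L} ≤ lhs K L ≤ |Λ_L|·m⁺_{KL-L}` (GKS + lattice shifts; the upper half is the birth line's `stub_plusSumLe`);
* `bbs_iff_avgOneArm` — **BBS ⟺ `∃ K ≥ 1, ∃ A, ∀ L ≥ 1, |Λ_L|·m⁺_{KL} ≤ A·√bulk L`**: one-arm hyperscaling against the
  BOX-AVERAGED two-point function;
* `card_sq_mul_axis_le_bulk` — MMS sup-norm comparison `|Λ_L|²·⟨σ₀σ_{6Le₀}⟩ ≤ bulk L` (the birth line's `stub_boxSumGe`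
  is `⟨card_sq_mul_axis_le_bulk L, criticalTwoPoint_three_nonneg _⟩`); `not_bbs_iff` — what a kill must deliver.

Part II (`Negative/WindowAndLadder.lean`): rigorous window, exponent ladder, the false `K = 0` slice.  The positive
composition `OneArmHyperscaling → BoundedBoundarySignal` is item evidence (`Disproof.lean`) for a prover.  Sources:
Friedli–Velenik 2017 Exercise 3.12, Thm 3.17; Aizenman–Duminil-Copin 2021 (5.3); the infrared bound — via tree theorems.

[folklore]
-/

noncomputable section

namespace Summit.CriticalPhenomena.Ising3DConformalLimit.BoundedBoundarySignalNegative

open Literature.Probability.LatticeModels Finset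
open Summit.CriticalPhenomena.Ising3DConformalLimit.Theses.PersistenceSpeed

/-- The boundary signal `Σ_{x ∈ Λ_L} ⟨σ_x⟩⁺_{Λ_{KL};β_c,0}`. [folklore] -/
def lhs (K L : ℕ) : ℝ :=
  ∑ x ∈ box 3 L, isingCorr (zdGraph 3) (box 3 (K * L)) (criticalBeta 3) 0 BoundaryCondition.plus
    ({x} : Finset (Site 3))

/-- The bulk variance sum `Σ_{x,y ∈ Λ_L} ⟨σ₀σ_{x-y}⟩⁺_{β_c}`. [folklore] -/
def bulk (L : ℕ) : ℝ :=
  ∑ x ∈ box 3 L, ∑ y ∈ box 3 L, criticalTwoPoint 3 (x - y)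

/-- The shorthands are the route decl verbatim. [folklore] -/
theorem bbs_iff : BoundedBoundarySignal ↔
    ∃ K : ℕ, 2 ≤ K ∧ ∃ A : ℝ, ∀ L : ℕ, 1 ≤ L → lhs K L ≤ A * Real.sqrt (bulk L) := Iff.rfl

/-! ## No junk: positivity and size of the two sides -/

/-- `criticalTwoPoint_three_nonneg` (bookkeeping for the BBS dictionary). [folklore] -/
theorem criticalTwoPoint_three_nonneg (z : Site 3) : 0 ≤ criticalTwoPoint 3 z :=
  (criticalTwoPoint_pos_of_three_le (d := 3) le_rfl z).le

/-- `criticalTwoPoint_three_zero` (bookkeeping for the BBS dictionary). [folklore] -/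
theorem criticalTwoPoint_three_zero : criticalTwoPoint 3 0 = 1 := by
  rw [criticalTwoPoint, twoPointPlus_origin]

/-- `one_le_bulk` (bookkeeping for the BBS dictionary). [folklore] -/
theorem one_le_bulk (L : ℕ) : 1 ≤ bulk L := by
  have h0 : (0 : Site 3) ∈ box 3 L := zero_mem_box 3 L
  calc (1 : ℝ) = criticalTwoPoint 3 ((0 : Site 3) - 0) := by
        rw [sub_zero, criticalTwoPoint_three_zero]
    _ ≤ ∑ y ∈ box 3 L, criticalTwoPoint 3 ((0 : Site 3) - y) :=
        Finset.single_le_sum (f := fun y => criticalTwoPoint 3 ((0 : Site 3) - y))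
          (fun y _ => criticalTwoPoint_three_nonneg _) h0
    _ ≤ bulk L :=
        Finset.single_le_sum (f := fun x => ∑ y ∈ box 3 L, criticalTwoPoint 3 (x - y))
          (fun x _ => Finset.sum_nonneg fun y _ => criticalTwoPoint_three_nonneg _) h0

/-- `bulk_pos` (bookkeeping for the BBS dictionary). [folklore] -/
theorem bulk_pos (L : ℕ) : 0 < bulk L := lt_of_lt_of_le one_pos (one_le_bulk L)

/-- `one_le_sqrt_bulk` (bookkeeping for the BBS dictionary). [folklore] -/
theorem one_le_sqrt_bulk (L : ℕ) : 1 ≤ Real.sqrt (bulk L) := by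
  rw [show (1 : ℝ) = Real.sqrt 1 by simp]
  exact Real.sqrt_le_sqrt (one_le_bulk L)

/-- `sqrt_bulk_pos` (bookkeeping for the BBS dictionary). [folklore] -/
theorem sqrt_bulk_pos (L : ℕ) : 0 < Real.sqrt (bulk L) := lt_of_lt_of_le one_pos (one_le_sqrt_bulk L)

/-- GKS I: the boundary signal is nonnegative (for `K ≥ 1`, so that the inner block lies in the volume). [folklore] -/
theorem lhs_nonneg {K : ℕ} (hK : 1 ≤ K) (L : ℕ) : 0 ≤ lhs K L := by
  refine Finset.sum_nonneg fun x hx => ?_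
  have hsub : ({x} : Finset (Site 3)) ⊆ box 3 (K * L) :=
    Finset.singleton_subset_iff.2 (box_mono 3 (Nat.le_mul_of_pos_left L hK) hx)
  exact GKSInequalities.gks_one_holds (G := zdGraph 3) (criticalBeta_nonneg 3) le_rfl (Or.inr rfl) hsub

/-- `Σ_{x∈Λ_L} ⟨σ_x⟩ ≤ |Λ_L|`. [folklore] -/
theorem lhs_le_card (K L : ℕ) : lhs K L ≤ #(box 3 L) := by
  calc lhs K L ≤ ∑ _x ∈ box 3 L, (1 : ℝ) :=
        Finset.sum_le_sum fun x _ => (abs_le.mp (abs_isingCorr_le_one _ _ _ _ _ _)).2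
    _ = #(box 3 L) := by simp

/-- Re-indexing: for `x ∈ Λ_L`, `Σ_{y∈Λ_L} ⟨σ₀σ_{x-y}⟩ ≤ Σ_{z∈Λ_{2L}} ⟨σ₀σ_z⟩` (`y ↦ x - y` is injective with
values in `Λ_{2L}`, summands `≥ 0`). [folklore] -/
theorem sum_box_sub_le {L : ℕ} {x : Site 3} (hx : x ∈ box 3 L) :
    ∑ y ∈ box 3 L, criticalTwoPoint 3 (x - y) ≤ ∑ z ∈ box 3 (2 * L), criticalTwoPoint 3 z := by
  have hinj : Set.InjOn (fun y : Site 3 => x - y) ↑(box 3 L) := fun y _ y' _ h => sub_right_injective h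
  rw [← Finset.sum_image hinj]
  refine Finset.sum_le_sum_of_subset_of_nonneg ?_ fun z _ _ => criticalTwoPoint_three_nonneg z
  intro z hz
  rw [Finset.mem_image] at hz
  obtain ⟨y, hy, rfl⟩ := hz
  rw [mem_box] at hx hy ⊢
  intro i
  have h1 := hx i
  have h2 := hy i
  simp only [Pi.sub_apply]
  push_cast
  omega


/-- **Box sum of the critical two-point function**: `Σ_{z∈Λ_R} ⟨σ₀σ_z⟩_{β_c} ≤ 1 + C·R²` (infrared bound
`⟨σ₀σ_z⟩ ≤ C‖z‖⁻¹`, `criticalTwoPoint_bounds_holds`, and the shell count `sum_box_erase_norm_rpow_le`). [folklore] -/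
theorem sum_box_criticalTwoPoint_le : ∃ C : ℝ, 0 < C ∧ ∀ R : ℕ,
    ∑ z ∈ box 3 R, criticalTwoPoint 3 z ≤ 1 + C * (R : ℝ) ^ 2 := by
  obtain ⟨c, C, hc, h⟩ := criticalTwoPoint_bounds_holds (d := 3) le_rfl
  refine ⟨54 * max C 0 + 1, by positivity, fun R => ?_⟩
  rw [← Finset.add_sum_erase _ _ (zero_mem_box 3 R), criticalTwoPoint_three_zero]
  have hle : ∀ z ∈ (box 3 R).erase 0, criticalTwoPoint 3 z ≤ max C 0 * ‖z‖ ^ (-(1 : ℝ)) := by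
    intro z hz
    have hz0 : z ≠ 0 := (Finset.mem_erase.1 hz).1
    have h2 := (h z hz0).2
    have e : (-(((3 : ℕ) : ℝ) - 2)) = (-1 : ℝ) := by norm_num
    rw [e] at h2
    exact h2.trans (mul_le_mul_of_nonneg_right (le_max_left _ _) (Real.rpow_nonneg (norm_nonneg _) _))
  have hshell := sum_box_erase_norm_rpow_le 1 R
  have hsum : ∑ m ∈ Finset.range R, ((m : ℝ) + 1) ^ (2 - (1 : ℝ)) ≤ (R : ℝ) ^ 2 := by
    have h1 : ∀ m ∈ Finset.range R, ((m : ℝ) + 1) ^ (2 - (1 : ℝ)) ≤ (R : ℝ) := by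
      intro m hm
      rw [show (2 : ℝ) - 1 = 1 by norm_num, Real.rpow_one]
      have := Finset.mem_range.1 hm
      exact_mod_cast this
    calc ∑ m ∈ Finset.range R, ((m : ℝ) + 1) ^ (2 - (1 : ℝ)) ≤ ∑ _m ∈ Finset.range R, (R : ℝ) :=
          Finset.sum_le_sum h1
      _ = (R : ℝ) ^ 2 := by rw [Finset.sum_const, Finset.card_range, nsmul_eq_mul]; ring
  calc 1 + ∑ z ∈ (box 3 R).erase 0, criticalTwoPoint 3 z
        ≤ 1 + ∑ z ∈ (box 3 R).erase 0, max C 0 * ‖z‖ ^ (-(1 : ℝ)) := by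
          gcongr with z hz; exact hle z hz
    _ = 1 + max C 0 * ∑ z ∈ (box 3 R).erase 0, ‖z‖ ^ (-(1 : ℝ)) := by rw [Finset.mul_sum]
    _ ≤ 1 + max C 0 * (54 * (R : ℝ) ^ 2) := by
          gcongr
          exact hshell.trans (by nlinarith [hsum])
    _ ≤ 1 + (54 * max C 0 + 1) * (R : ℝ) ^ 2 := by nlinarith [sq_nonneg (R : ℝ)]

/-- **`bulk L ≤ C₅·L⁵`** for `L ≥ 1` (re-indexing + the box sum bound): the bulk variance sum is at most
`|Λ_L|·(1 + 4C·L²)`, i.e. `sd_L ≲ L^{5/2}` — the `Δσ ≥ 1/2` edge of the rigorous window. [folklore] -/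
theorem bulk_le_pow_five : ∃ C₅ : ℝ, 0 < C₅ ∧ ∀ L : ℕ, 1 ≤ L → bulk L ≤ C₅ * (L : ℝ) ^ 5 := by
  obtain ⟨C, hC, h⟩ := sum_box_criticalTwoPoint_le
  refine ⟨27 * (1 + 4 * C), by positivity, fun L hL => ?_⟩
  have hL1 : (1 : ℝ) ≤ L := by exact_mod_cast hL
  have h1 : bulk L ≤ #(box 3 L) * (1 + C * ((2 * L : ℕ) : ℝ) ^ 2) := by
    calc bulk L ≤ ∑ _x ∈ box 3 L, ∑ z ∈ box 3 (2 * L), criticalTwoPoint 3 z :=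
          Finset.sum_le_sum fun x hx => sum_box_sub_le hx
      _ ≤ ∑ _x ∈ box 3 L, (1 + C * ((2 * L : ℕ) : ℝ) ^ 2) := Finset.sum_le_sum fun x _ => h (2 * L)
      _ = #(box 3 L) * (1 + C * ((2 * L : ℕ) : ℝ) ^ 2) := by rw [Finset.sum_const, nsmul_eq_mul]
  have hcard : (#(box 3 L) : ℝ) ≤ 27 * (L : ℝ) ^ 3 := by
    rw [card_box]; push_cast; nlinarith [pow_le_pow_left₀ (by positivity : (0:ℝ) ≤ 2 * L + 1) (by linarith : (2 : ℝ) * L + 1 ≤ 3 * L) 3]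
  have h2 : 1 + C * ((2 * L : ℕ) : ℝ) ^ 2 ≤ (1 + 4 * C) * (L : ℝ) ^ 2 := by push_cast; nlinarith
  calc bulk L ≤ #(box 3 L) * (1 + C * ((2 * L : ℕ) : ℝ) ^ 2) := h1
    _ ≤ (27 * (L : ℝ) ^ 3) * ((1 + 4 * C) * (L : ℝ) ^ 2) := by gcongr
    _ = 27 * (1 + 4 * C) * (L : ℝ) ^ 5 := by ring

/-- `√bulk L ≤ C₆ · L^{5/2}` for `L ≥ 1`. [folklore] -/
theorem sqrt_bulk_le_pow : ∃ C₆ : ℝ, 0 < C₆ ∧ ∀ L : ℕ, 1 ≤ L →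
    Real.sqrt (bulk L) ≤ C₆ * (L : ℝ) ^ (5 / 2 : ℝ) := by
  obtain ⟨C₅, hC₅, h⟩ := bulk_le_pow_five
  refine ⟨Real.sqrt C₅, by positivity, fun L hL => ?_⟩
  have hL0 : (0 : ℝ) ≤ L := Nat.cast_nonneg _
  have h1 := Real.sqrt_le_sqrt (h L hL)
  rw [Real.sqrt_mul hC₅.le] at h1
  refine h1.trans (le_of_eq ?_)
  congr 1
  rw [Real.sqrt_eq_rpow, ← Real.rpow_natCast, ← Real.rpow_mul hL0]
  norm_num

/-! ## Quantifier order, the degenerate instance, the sign of the constant, frozen spins -/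

/-- With `A` allowed to depend on `L` the inequality is empty of content. [folklore] -/
theorem swapped_trivial (K L : ℕ) : ∃ A : ℝ, lhs K L ≤ A * Real.sqrt (bulk L) :=
  ⟨|lhs K L|, (le_abs_self _).trans (le_mul_of_one_le_right (abs_nonneg _) (one_le_sqrt_bulk L))⟩

/-- The excluded instance `L = 0` holds for every aspect ratio and every `A ≥ 1`
(`|Λ_0| = 1`, `|⟨σ₀⟩| ≤ 1 ≤ √bulk 0`). [folklore] -/
theorem at_zero (K : ℕ) {A : ℝ} (hA : 1 ≤ A) : lhs K 0 ≤ A * Real.sqrt (bulk 0) := by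
  have h1 : lhs K 0 ≤ 1 := by simpa [card_box] using lhs_le_card K 0
  have h2 : (1 : ℝ) ≤ A * Real.sqrt (bulk 0) := one_le_mul_of_one_le_of_one_le hA (one_le_sqrt_bulk 0)
  linarith

/-- Every witness constant is nonnegative. [folklore] -/
theorem witness_nonneg {K : ℕ} {A : ℝ} (hK : 1 ≤ K)
    (h : ∀ L : ℕ, 1 ≤ L → lhs K L ≤ A * Real.sqrt (bulk L)) : 0 ≤ A := by
  by_contra hA
  push Not at hA
  have h1 := h 1 le_rfl
  have hneg : A * Real.sqrt (bulk 1) < 0 := mul_neg_of_neg_of_pos hA (sqrt_bulk_pos 1)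
  have := lhs_nonneg hK 1
  linarith

/-- Frozen outside spins: for `x ∉ Λ`, `⟨σ_x⟩⁺_{Λ;β,h} = 1` (the `+` boundary condition fixes `σ_x = 1`). [folklore] -/
theorem isingCorr_plus_singleton_of_not_mem {Λ : Finset (Site 3)} {x : Site 3} (hx : x ∉ Λ) (β h : ℝ) :
    isingCorr (zdGraph 3) Λ β h BoundaryCondition.plus ({x} : Finset (Site 3)) = 1 := by
  rw [isingCorr, isingExpect, integral_isingMeasure (zdGraph 3) Λ β h _ (measurable_spinProduct _)]
  have hsp : ∀ τ : ↥Λ → ℤˣ, spinProduct ({x} : Finset (Site 3)) (glue Λ τ BoundaryCondition.plus) = 1 := by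
    intro τ
    have hg : glue Λ τ BoundaryCondition.plus x = 1 := by
      rw [glue_apply_of_notMem _ _ _ hx]; rfl
    simp [spinProduct, spinAt, hg]
  simp_rw [hsp, mul_one]
  exact div_self (isingPartitionFunction_pos _ _ _ _ _).ne'

/-! ## GKS volume antitonicity -/

/-- `lhs_anti` (bookkeeping for the BBS dictionary). [folklore] -/
theorem lhs_anti {K K' : ℕ} (hK : 1 ≤ K) (hKK' : K ≤ K') (L : ℕ) : lhs K' L ≤ lhs K L := by
  refine Finset.sum_le_sum fun x hx => ?_
  have hsub : ({x} : Finset (Site 3)) ⊆ box 3 (K * L) :=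
    Finset.singleton_subset_iff.2 (box_mono 3 (Nat.le_mul_of_pos_left L hK) hx)
  have h12 : box 3 (K * L) ⊆ box 3 (K' * L) := box_mono 3 (Nat.mul_le_mul_right L hKK')
  exact isingCorr_plus_le_of_subset (G := zdGraph 3) (criticalBeta_nonneg 3) le_rfl hsub h12

/-- The `K`-slice is monotone in `K`: a larger collar only weakens the boundary signal. [folklore] -/
theorem slice_mono {K K' : ℕ} {A : ℝ} (hK : 1 ≤ K) (hKK' : K ≤ K')
    (h : ∀ L : ℕ, 1 ≤ L → lhs K L ≤ A * Real.sqrt (bulk L)) :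
    ∀ L : ℕ, 1 ≤ L → lhs K' L ≤ A * Real.sqrt (bulk L) :=
  fun L hL => (lhs_anti hK hKK' L).trans (h L hL)

/-- BBS ↔ arbitrarily large aspect ratios work (with the same constant). [folklore] -/
theorem bbs_iff_cofinal : BoundedBoundarySignal ↔
    ∀ K₀ : ℕ, ∃ K : ℕ, K₀ ≤ K ∧ 2 ≤ K ∧ ∃ A : ℝ, ∀ L : ℕ, 1 ≤ L → lhs K L ≤ A * Real.sqrt (bulk L) := by
  constructor
  · rintro ⟨K, hK, A, h⟩ K₀
    exact ⟨max K K₀, le_max_right _ _, hK.trans (le_max_left _ _), A,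
      slice_mono (by omega) (le_max_left _ _) h⟩
  · intro h
    obtain ⟨K, -, hK2, A, hA⟩ := h 2
    exact ⟨K, hK2, A, hA⟩

/-! ## The one-arm quantity and the translation sandwich -/

/-- `m⁺_R := ⟨σ₀⟩⁺_{Λ_R;β_c(3),0}` (= `plusBoxMag`, the wired FK-Ising one-arm quantity). [folklore] -/
def boxMag (R : ℕ) : ℝ :=
  isingCorr (zdGraph 3) (box 3 R) (criticalBeta 3) 0 BoundaryCondition.plus ({0} : Finset (Site 3))

/-- `boxMag_nonneg` (bookkeeping for the BBS dictionary). [folklore] -/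
theorem boxMag_nonneg (R : ℕ) : 0 ≤ boxMag R :=
  GKSInequalities.gks_one_holds (G := zdGraph 3) (criticalBeta_nonneg 3) le_rfl (Or.inr rfl)
    (Finset.singleton_subset_iff.2 (zero_mem_box 3 R))

/-- `boxMag_le_one` (bookkeeping for the BBS dictionary). [folklore] -/
theorem boxMag_le_one (R : ℕ) : boxMag R ≤ 1 :=
  (abs_le.1 (abs_isingCorr_le_one (zdGraph 3) (box 3 R) (criticalBeta 3) 0 .plus {0})).2

/-- `R ↦ m⁺_R` is non-increasing (GKS volume antitonicity). [folklore] -/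
theorem boxMag_antitone {R R' : ℕ} (h : R ≤ R') : boxMag R' ≤ boxMag R :=
  isingCorr_plus_le_of_subset (G := zdGraph 3) (criticalBeta_nonneg 3) le_rfl
    (Finset.singleton_subset_iff.2 (zero_mem_box 3 R)) (box_mono 3 h)

/-- `map_singleton_zero` (bookkeeping for the BBS dictionary). [folklore] -/
private theorem map_singleton_zero (x : Site 3) :
    ({0} : Finset (Site 3)).map (Site.shift x).toEmbedding = {x} := by
  rw [Finset.map_singleton]
  simp

/-- Pointwise upper half: for `x ∈ Λ_L` and `M + L ≤ R`, `⟨σ_x⟩⁺_{Λ_R} ≤ m⁺_M`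
(`x + Λ_M ⊆ Λ_R`, GKS volume antitonicity, translation). [folklore] -/
theorem corr_le_boxMag {L M R : ℕ} {x : Site 3} (hx : x ∈ box 3 L) (hMR : M + L ≤ R) :
    isingCorr (zdGraph 3) (box 3 R) (criticalBeta 3) 0 BoundaryCondition.plus ({x} : Finset (Site 3))
      ≤ boxMag M := by
  have hxn : Site.supNorm x ≤ L := mem_box_iff_supNorm_le.1 hx
  have h1 : (box 3 M).map (Site.shift x).toEmbedding ⊆ box 3 R :=
    (map_shift_box_subset M x).trans (box_mono 3 (by omega))
  have hA : ({0} : Finset (Site 3)).map (Site.shift x).toEmbedding ⊆ (box 3 M).map (Site.shift x).toEmbedding :=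
    Finset.map_subset_map.2 (Finset.singleton_subset_iff.2 (zero_mem_box 3 M))
  rw [← map_singleton_zero x]
  calc isingCorr (zdGraph 3) (box 3 R) (criticalBeta 3) 0 BoundaryCondition.plus
          (({0} : Finset (Site 3)).map (Site.shift x).toEmbedding)
        ≤ isingCorr (zdGraph 3) ((box 3 M).map (Site.shift x).toEmbedding) (criticalBeta 3) 0 .plus
          (({0} : Finset (Site 3)).map (Site.shift x).toEmbedding) :=
        isingCorr_plus_le_of_subset (G := zdGraph 3) (criticalBeta_nonneg 3) le_rfl hA h1
    _ = boxMag M := isingCorr_plus_map_shift x (box 3 M) {0} _ _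

/-- Pointwise lower half: for `x ∈ Λ_L ⊆ Λ_R` and `R + L ≤ R'`, `m⁺_{R'} ≤ ⟨σ_x⟩⁺_{Λ_R}`
(`Λ_R ⊆ x + Λ_{R'}`). [folklore] -/
theorem boxMag_le_corr {L R R' : ℕ} {x : Site 3} (hx : x ∈ box 3 L) (hLR : L ≤ R) (hR' : R + L ≤ R') :
    boxMag R' ≤
      isingCorr (zdGraph 3) (box 3 R) (criticalBeta 3) 0 BoundaryCondition.plus ({x} : Finset (Site 3)) := by
  have hxn : Site.supNorm x ≤ L := mem_box_iff_supNorm_le.1 hx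
  have hA : ({x} : Finset (Site 3)) ⊆ box 3 R := Finset.singleton_subset_iff.2 (box_mono 3 hLR hx)
  have h12 : box 3 R ⊆ (box 3 R').map (Site.shift x).toEmbedding :=
    (box_subset_map_shift_box R x).trans (Finset.map_subset_map.2 (box_mono 3 (by omega)))
  have key := isingCorr_plus_le_of_subset (G := zdGraph 3) (criticalBeta_nonneg 3) le_rfl hA h12
  rw [← map_singleton_zero x, isingCorr_plus_map_shift x (box 3 R') {0}] at key
  rwa [← map_singleton_zero x]

/-- **Upper half of the sandwich** (= the birth line's `stub_plusSumLe`): `lhs K L ≤ |Λ_L| · m⁺_M` whenever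
`M + L ≤ K L` (e.g. `M = (K-1)L`). [folklore] -/
theorem lhs_le_card_mul_boxMag {K L M : ℕ} (hM : M + L ≤ K * L) : lhs K L ≤ #(box 3 L) * boxMag M := by
  calc lhs K L ≤ ∑ _x ∈ box 3 L, boxMag M := Finset.sum_le_sum fun x hx => corr_le_boxMag hx hM
    _ = #(box 3 L) * boxMag M := by rw [Finset.sum_const, nsmul_eq_mul]

/-- **Lower half of the sandwich**: `|Λ_L| · m⁺_{R'} ≤ lhs K L` whenever `K ≥ 1` and `K L + L ≤ R'`. [folklore] -/
theorem card_mul_boxMag_le_lhs {K L R' : ℕ} (hK : 1 ≤ K) (hR' : K * L + L ≤ R') :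
    #(box 3 L) * boxMag R' ≤ lhs K L := by
  have hLR : L ≤ K * L := by nlinarith
  calc (#(box 3 L) : ℝ) * boxMag R' = ∑ _x ∈ box 3 L, boxMag R' := by rw [Finset.sum_const, nsmul_eq_mul]
    _ ≤ lhs K L := Finset.sum_le_sum fun x hx => boxMag_le_corr hx hLR hR'

/-! ## Reformulation: one-arm hyperscaling against the box-averaged two-point function -/

/-- `slice_succ_of_avgOneArm` (bookkeeping for the BBS dictionary). [folklore] -/
theorem slice_succ_of_avgOneArm {K : ℕ} {A : ℝ}
    (h : ∀ L : ℕ, 1 ≤ L → (#(box 3 L) : ℝ) * boxMag (K * L) ≤ A * Real.sqrt (bulk L)) :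
    ∀ L : ℕ, 1 ≤ L → lhs (K + 1) L ≤ A * Real.sqrt (bulk L) :=
  fun L hL => (lhs_le_card_mul_boxMag (by rw [Nat.succ_mul])).trans (h L hL)

/-- `avgOneArm_succ_of_slice` (bookkeeping for the BBS dictionary). [folklore] -/
theorem avgOneArm_succ_of_slice {K : ℕ} {A : ℝ} (hK : 1 ≤ K)
    (h : ∀ L : ℕ, 1 ≤ L → lhs K L ≤ A * Real.sqrt (bulk L)) :
    ∀ L : ℕ, 1 ≤ L → (#(box 3 L) : ℝ) * boxMag ((K + 1) * L) ≤ A * Real.sqrt (bulk L) :=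
  fun L hL => (card_mul_boxMag_le_lhs hK (by rw [Nat.succ_mul])).trans (h L hL)

/-- **BBS ⟺ ∃ K ≥ 1, ∃ A, ∀ L ≥ 1, |Λ_L|·⟨σ₀⟩⁺_{Λ_{KL}} ≤ A·(Σ_{x,y∈Λ_L}⟨σ_xσ_y⟩)^{1/2}.** [folklore] -/
theorem bbs_iff_avgOneArm : BoundedBoundarySignal ↔
    ∃ K : ℕ, 1 ≤ K ∧ ∃ A : ℝ, ∀ L : ℕ, 1 ≤ L → (#(box 3 L) : ℝ) * boxMag (K * L) ≤ A * Real.sqrt (bulk L) := by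
  constructor
  · rintro ⟨K, hK, A, h⟩
    exact ⟨K + 1, by omega, A, avgOneArm_succ_of_slice (by omega) h⟩
  · rintro ⟨K, hK, A, h⟩
    exact ⟨K + 1, by omega, A, slice_succ_of_avgOneArm h⟩

/-! ## MMS box comparison -/

/-- `x, y ∈ Λ_L ⇒ 3‖x - y‖_∞ ≤ 6L = ‖6L e₀‖_∞`. [folklore] -/
private theorem three_mul_supNorm_sub_le {L : ℕ} {x y : Site 3} (hx : x ∈ box 3 L) (hy : y ∈ box 3 L) :
    3 * Site.supNorm (x - y) ≤ Site.supNorm (Pi.single 0 (2 * ((3 * L : ℕ) : ℤ)) : Site 3) := by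
  have hxy : x - y ∈ box 3 (2 * L) := by
    rw [mem_box] at hx hy ⊢
    intro i
    have h1 := hx i
    have h2 := hy i
    simp only [Pi.sub_apply]
    push_cast
    omega
  have h3 : Site.supNorm (x - y) ≤ 2 * L := mem_box_iff_supNorm_le.1 hxy
  have h4 : 6 * L ≤ Site.supNorm (Pi.single 0 (2 * ((3 * L : ℕ) : ℤ)) : Site 3) := by
    have := Site.natAbs_le_supNorm (Pi.single 0 (2 * ((3 * L : ℕ) : ℤ)) : Site 3) 0
    simp only [Pi.single_eq_same] at this
    omega
  omega

/-- **MMS box comparison** (= the birth line's `stub_boxSumGe`):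
`|Λ_L|² · ⟨σ₀σ_{6Le₀}⟩_{β_c} ≤ Σ_{x,y∈Λ_L} ⟨σ₀σ_{x-y}⟩_{β_c}` (sup-norm Messager–Miracle-Solé,
Aizenman–Duminil-Copin 2021 (5.3): `‖y‖_∞ ≥ 3‖x‖_∞ ⇒ S(y) ≤ S(x)`). [folklore] -/
theorem card_sq_mul_axis_le_bulk (L : ℕ) :
    (#(box 3 L) : ℝ) ^ 2 * criticalTwoPoint 3 (Pi.single 0 (2 * ((3 * L : ℕ) : ℤ))) ≤ bulk L := by
  calc (#(box 3 L) : ℝ) ^ 2 * criticalTwoPoint 3 (Pi.single 0 (2 * ((3 * L : ℕ) : ℤ)))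
        = ∑ _x ∈ box 3 L, ∑ _y ∈ box 3 L, criticalTwoPoint 3 (Pi.single 0 (2 * ((3 * L : ℕ) : ℤ))) := by
          rw [Finset.sum_const, nsmul_eq_mul, Finset.sum_const, nsmul_eq_mul]; ring
    _ ≤ bulk L := Finset.sum_le_sum fun x hx => Finset.sum_le_sum fun y hy =>
          twoPointPlus_le_of_mul_supNorm_le (d := 3) (criticalBeta_nonneg 3) (three_mul_supNorm_sub_le hx hy)

/-- What a refutation must deliver: an unbounded ratio at EVERY aspect ratio `K ≥ 2`. [folklore] -/
theorem not_bbs_iff : ¬ BoundedBoundarySignal ↔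
    ∀ K : ℕ, 2 ≤ K → ∀ A : ℝ, ∃ L : ℕ, 1 ≤ L ∧ A * Real.sqrt (bulk L) < lhs K L := by
  simp only [bbs_iff, not_exists, not_and, not_forall, not_le, exists_prop]

end Summit.CriticalPhenomena.Ising3DConformalLimit.BoundedBoundarySignalNegative

end
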